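import Summits.HodgeConjecture.HodgeConjecture.Theorems.MarkmanPartnerTransportPicardThreeK3SquaresZeta11TypePicardTwo
import Summits.HodgeConjecture.HodgeConjecture.Theorems.MarkmanPartnerTransportPicardThreeK3SquaresZeta11Theta
import Literature.NumberTheory.NumberFields.CyclicQuinticField11
import HarnessLib

/-!
# Route MarkmanPartnerTransport · crux `PicardThreeK3Squares` (stmt-HodgeConjecture-19652) —
# HC⁴(S ⊗ S) for the ζ₁₁ real-multiplication type FROM THE CONJUGACY ALONE

Cell hodge-nonav, crux #4, INDEX row M-θ₁₁ / cell (3,5) (prover seat hodge-nonav-19652-p1 gen 13; INDEX v49 §6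
A12; `--supports stmt-HodgeConjecture-19652`, helper). `hodgeConjectureFor_square_of_zeta11Type` (gen 11) asks,
for a K3 surface of the ζ₁₁ rational RM type, an annihilating separable `P` with `P(0) ≠ 0` and the generation
clause `TranscendentalEndomorphismsGeneratedBy S t`. Here BOTH are derived from the rational conjugacy
`σηt = θ_ℂση` alone (with `…Zeta11ModelAlgebra`, `…Zeta11TypePicardTwo`):

* `eigenvalue_ne_two_of_zeta11Model` — the `(2,0)`-eigenvalue `ev` of `t` is not `2`: else `π_U(σx) = 0`,
  `(g + g⁻¹)σx = 2σx`, so `gσx = σx` (`(g - 1)²σx = 0`, `g¹¹ = 1`); then every `ge - e` (`e ∈ Λ`) is an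
  integral vector orthogonal to `σx`, killed by `θ` by the `θ`-GENERICITY of `σx`
  (`generic_and_posKernel_of_marking`: Lefschetz `(1,1)` + `t` kills `N¹`), so fixed by `π_U` and killed by
  `π_U`: `g = 1`, contradicting `g y₀ = ζ₁₁ y₀`. (This replaces the base-change lemma "an integer matrix with
  a complex kernel vector has a rational one" foreseen for this step: none is needed.)
* `minpoly_natDegree_eq_five` — a complex root of `P₁₁ = X⁵ + X⁴ - 4X³ - 3X² + 3X + 1` has minimal
  polynomial `P₁₁` (irreducible: TREE theorem `CyclicQuintic11.quinticPolyRat_irreducible`); `sextic_separable`,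
  `sextic_eval_zero_ne` — `Q₁₁ = (X - 2)P₁₁` is separable with `Q₁₁(0) = -2`.
* **`hodgeConjectureFor_square_of_zeta11Type_of_conj`** — for EVERY datum of the fact and EVERY marked
  projective K3 surface with an endomorphism `t` (rational, type-preserving, killing `N¹`, image `⊥ N¹`)
  conjugate by a rational isometry to `θ_ℂ`: `HodgeConjectureFor 4 (S ⊗ S)` — hypotheses = marking +
  conjugacy ONLY (`ρ(S) = 2`, `Q₁₁(t)|_T = 0`, `deg minpoly ev = 5`, one-cycle degree law `5jm + 2 ≠ 22` ⇒
  generated-or-CM; CM branch = Buskin's corollary).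
* **`finrank_algebraicClasses_eq_two_of_zeta11Theta`**, **`hodgeConjectureFor_square_of_zeta11Theta_of_conj`**
  — the same for the NAMED explicit type `θ₁₁ = zeta11Theta` (gen 11's kernel-checked order-`11` isometry of
  `Λ = E₈(-1)² ⊕ U³`): every K3 surface RM-isogenous to a member of the van Geemen–Schütt ζ₁₁ family has
  `ρ = 2` and satisfies HC⁴(S ⊗ S), CONDITIONAL on {`Buskin2019_hodgeIsometry_algebraic`,
  `VanGeemenSchuett2025_OguisoZhang2011_zeta11_cycleOnOpenPeriodSet`, `Huybrechts_K3_marking_exists`,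
  `Buskin2019_hodgeConjectureFor_square_of_CM`}; credits nothing; HC is NOT proved here.

No definition, no sorry, no new fact. References: van Geemen–Schütt, Forum Math. Sigma 13 (2025) e2, Thm. 1.1
(11), §4.8, §5.8; Oguiso–Zhang, PAMQ 7 (2011), Thm. 1.5; van Geemen 2008, Lemma 3.2; Buskin, Crelle 755 (2019).
-/

set_option linter.dupNamespace false

noncomputable section

namespace Summit.HodgeConjecture.HodgeConjecture.Theorems.MarkmanPartnerTransport.RMTypeOrbit

open CategoryTheory MonoidalCategory Polynomial
open Literature.AlgebraicGeometry Literature.AlgebraicGeometry.Motives Literature.AlgebraicGeometry.HodgeTheory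
open Literature.AlgebraicGeometry.Surfaces Literature.LinearAlgebra.QuadraticForm
open Literature.AlgebraicTopology.SingularHomology
open Summit.HodgeConjecture.HodgeConjecture.Theorems.NikulinTwinTransport
open Summit.HodgeConjecture.HodgeConjecture.Theorems.MarkmanPartnerTransport.IsogenyInvariance
open Summit.HodgeConjecture.HodgeConjecture.Theorems.MarkmanPartnerTransport.RMTypeDescent

/-- `MarkedK3[S, η, p, x]`: VERBATIM the `let MarkedK3 := …` binder of the route declaration
`PicardThreeK3Squares` (as in `…RMTypeDescent`). Local notation only. -/
local notation3 (prettyPrint := false) "MarkedK3[" S ", " η ", " p ", " x "]" =>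
  (p ≠ 0 ∧ (IsIntegralClass p ∧
    (∀ q : complexBetti S (2 * 2), IsIntegralClass q → ∃ n : ℤ, q = n • p) ∧
    (∀ c : complexBetti S (2 * 1), IsIntegralClass c ↔ ∃ v : K3Index → ℤ, η c = fun i => (v i : ℂ)) ∧
    (∀ a b : complexBetti S (2 * 1),
      cupProduct (rfl : 2 * 1 + 2 * 1 = 2 * 2) a b = k3Form (η a) (η b) • p) ∧
    IsOfHodgeType 2 S (2 * 1) 2 0 (LinearEquiv.symm η x) ∧
    (∀ τ : complexBetti S (2 * 1), IsOfHodgeType 2 S (2 * 1) 2 0 τ →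
      ∃ t : ℂ, τ = t • LinearEquiv.symm η x)) ∧
    (k3Form x x = 0 ∧ 0 < (k3Form (star x) x).re ∧
      ∃ u : K3Index → ℤ, k3Form (fun i => (u i : ℂ)) x = 0 ∧ 0 < ∑ i, ∑ j, u i * k3Gram i j * u j))

/-- `Zeta11Model[g, u₁, u₂, y₀, θ]`: VERBATIM the antecedents of the named fact
`VanGeemenSchuett2025_OguisoZhang2011_zeta11_cycleOnOpenPeriodSet` (as in `…PicardThreeK3SquaresZeta11Type`).
Local notation only. -/
local notation3 (prettyPrint := false) "Zeta11Model[" g ", " u₁ ", " u₂ ", " y₀ ", " θ "]" =>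
  ((∀ a b : K3Index → ℂ, k3Form (g a) (g b) = k3Form a b) ∧
    (∀ v : K3Index → ℤ, ∃ w : K3Index → ℤ,
      g (fun i => ((v i : ℤ) : ℂ)) = fun i => ((w i : ℤ) : ℂ)) ∧
    g ^ 11 = 1 ∧
    g (fun i => ((u₁ i : ℤ) : ℂ)) = (fun i => ((u₁ i : ℤ) : ℂ)) ∧
    g (fun i => ((u₂ i : ℤ) : ℂ)) = (fun i => ((u₂ i : ℤ) : ℂ)) ∧
    k3Form (fun i => ((u₁ i : ℤ) : ℂ)) (fun i => ((u₁ i : ℤ) : ℂ)) = 0 ∧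
    k3Form (fun i => ((u₂ i : ℤ) : ℂ)) (fun i => ((u₂ i : ℤ) : ℂ)) = 0 ∧
    k3Form (fun i => ((u₁ i : ℤ) : ℂ)) (fun i => ((u₂ i : ℤ) : ℂ)) = 1 ∧
    (∀ v : K3Index → ℤ, g (fun i => ((v i : ℤ) : ℂ)) = (fun i => ((v i : ℤ) : ℂ)) →
      ∃ m n : ℤ, v = m • u₁ + n • u₂) ∧
    k3Form y₀ y₀ = 0 ∧ 0 < (k3Form (star y₀) y₀).re ∧
    g y₀ = Complex.exp (2 * Real.pi * Complex.I / 11) • y₀ ∧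
    (∀ y : K3Index → ℂ, thetaC θ y =
      g y + (g ^ 10) y - (2 * k3Form y (fun i => ((u₂ i : ℤ) : ℂ))) • (fun i => ((u₁ i : ℤ) : ℂ))
        - (2 * k3Form y (fun i => ((u₁ i : ℤ) : ℂ))) • (fun i => ((u₂ i : ℤ) : ℂ))))

/-- `πU[u₁, u₂]`: the `k3Form`-orthogonal projector `y ↦ (y.u₂)u₁ + (y.u₁)u₂` onto the hyperbolic plane
`ℂu₁ ⊕ ℂu₂` (for `(u₁.u₁) = (u₂.u₂) = 0`, `(u₁.u₂) = 1`). Local notation only. -/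
local notation3 (prettyPrint := false) "πU[" u₁ ", " u₂ "]" =>
  ((LinearMap.smulRight (k3FormC (fun i : K3Index => ((u₂ i : ℤ) : ℂ))) (fun i : K3Index => ((u₁ i : ℤ) : ℂ)) +
      LinearMap.smulRight (k3FormC (fun i : K3Index => ((u₁ i : ℤ) : ℂ))) (fun i : K3Index => ((u₂ i : ℤ) : ℂ)) :
    Module.End ℂ (K3Index → ℂ)))

/-- `Q₁₁ = (X - 2)(X⁵ + X⁴ - 4X³ - 3X² + 3X + 1) ∈ ℚ[X]`: `X - 2` times the minimal polynomial of `ζ₁₁ + ζ₁₁⁻¹`.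
Local notation only. -/
local notation3 (prettyPrint := false) "Q₁₁" =>
  ((X - C (2 : ℚ)) * (X ^ 5 + X ^ 4 - C (4 : ℚ) * X ^ 3 - C (3 : ℚ) * X ^ 2 + C (3 : ℚ) * X + 1) : ℚ[X])

variable {g : Module.End ℂ (K3Index → ℂ)} {u₁ u₂ : K3Index → ℤ} {y₀ : K3Index → ℂ}
  {θ : Matrix K3Index K3Index ℚ} {S : SchemeOver ℂ}

/-! ### The `(2,0)`-eigenvalue is not `2` -/

/-- `gᵏ v = v + k·(g v - v)` whenever `g(g v - v) = g v - v`. [folklore] -/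
theorem pow_apply_eq_add_smul_of_fixed_diff {v : K3Index → ℂ} (hu : g (g v - v) = g v - v) (k : ℕ) :
    (g ^ k) v = v + (k : ℂ) • (g v - v) := by
  induction k with
  | zero => simp
  | succ k ih =>
    rw [pow_succ', Module.End.mul_apply, ih, map_add, map_smul, hu, Nat.cast_succ, add_smul, one_smul]
    abel

/-- **The `(2,0)`-eigenvalue of an endomorphism conjugate to a ζ₁₁ model is not `2`.** If `θ_ℂ(σx) = 2σx`
then `π_U(σx) = 0` and `(g + g⁻¹)σx = 2σx`, so `(g - 1)²σx = 0` and (as `g¹¹ = 1`) `gσx = σx`. Then for every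
lattice vector `e`, `ge - e` is an integral vector orthogonal to `σx` (`g` is an isometry), hence killed by
`θ` (the `θ`-GENERICITY of `σx`, `generic_and_posKernel_of_marking`: Lefschetz `(1,1)` + `t` kills `N¹`),
hence fixed by `π_U`; but `π_U(ge - e) = π_U e - π_U e = 0`. So `g = 1`, contradicting `g y₀ = ζ₁₁ y₀`,
`y₀ ≠ 0`. Fact-free; no base change. [cite: GeemenSchutt2023, §2.1 and §4.8]
[cite: Huybrechts2016K3, Ch. 3 §3.2] -/
theorem eigenvalue_ne_two_of_zeta11Model (hZ : Zeta11Model[g, u₁, u₂, y₀, θ]) (hS : IsK3Surface S)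
    (η : complexBetti S (2 * 1) ≃ₗ[ℂ] (K3Index → ℂ)) (p : complexBetti S (2 * 2)) (x : K3Index → ℂ)
    (hM : MarkedK3[S, η, p, x])
    (t : complexBetti S (2 * 1) →ₗ[ℂ] complexBetti S (2 * 1))
    (ht_N : ∀ d ∈ algebraicClasses S 1, t d = 0)
    (σ : Module.End ℂ (K3Index → ℂ)) (hσ : ∀ a b, k3Form (σ a) (σ b) = k3Form a b)
    (hσrat : ∀ v : K3Index → ℤ, ∃ w : K3Index → ℚ, σ (fun i => (v i : ℂ)) = fun i => (w i : ℂ))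
    (hconj : ∀ c : complexBetti S (2 * 1), σ (η (t c)) = thetaC θ (σ (η c)))
    {ev : ℂ} (hev : t (η.symm x) = ev • η.symm x) : ev ≠ 2 := by
  classical
  intro hev2
  have hg := hZ.1
  have hgint := hZ.2.1
  have hg11 : g ^ 11 = 1 := hZ.2.2.1
  have hy₀pos := hZ.2.2.2.2.2.2.2.2.2.2.1
  have hgy₀ := hZ.2.2.2.2.2.2.2.2.2.2.2.1
  obtain ⟨hgenσ, -⟩ := generic_and_posKernel_of_marking hS η p x hM t ht_N σ hσ hσrat hconj
  -- `θ (σ x) = 2 σ x`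
  have heig : thetaC θ (σ x) = (2 : ℂ) • σ x := by
    have h := hconj (η.symm x)
    rw [hev, hev2, map_smul, LinearEquiv.apply_symm_apply, map_smul] at h
    exact h.symm
  -- `π_U (σ x) = 0`
  have hπ0 : πU[u₁, u₂] (σ x) = 0 := by
    have h : (πU[u₁, u₂] * thetaC θ) (σ x) = 0 := by rw [piU_mul_thetaC hZ, LinearMap.zero_apply]
    rw [Module.End.mul_apply, heig, map_smul] at h
    exact (smul_eq_zero.1 h).resolve_left two_ne_zero
  -- `(g + g¹⁰) σx = 2 σx`, hence `g σx = σx`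
  have hw : (g + g ^ 10) (σ x) = (2 : ℂ) • σ x := by rw [← thetaC_apply_of_piU_eq_zero hZ hπ0, heig]
  have hfix : g (σ x) = σ x := by
    set v := σ x with hv
    have h11v : (g ^ 11) v = v := by rw [hg11, Module.End.one_apply]
    have hgw : g ((g + g ^ 10) v) = (2 : ℂ) • g v := by rw [hw, map_smul]
    have e : g ((g ^ 10) v) = v := by
      rw [← Module.End.mul_apply, ← pow_succ', h11v]
    rw [LinearMap.add_apply, map_add, e] at hgw
    -- `g (g v) + v = 2 g v`
    have hu : g (g v - v) = g v - v := by
      rw [map_sub]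
      have : g (g v) = (2 : ℂ) • g v - v := eq_sub_of_add_eq hgw
      rw [this, two_smul]
      abel
    have h := pow_apply_eq_add_smul_of_fixed_diff hu 11
    rw [h11v] at h
    have h0 : ((11 : ℕ) : ℂ) • (g v - v) = 0 := by
      have := congrArg (fun z => z - v) h
      simpa using this.symm
    have h11 : ((11 : ℕ) : ℂ) ≠ 0 := by norm_num
    exact sub_eq_zero.1 ((smul_eq_zero.1 h0).resolve_left h11)
  -- every basis vector is fixed by `g`
  have hcast : ∀ i : K3Index,
      (Pi.single i (1 : ℂ) : K3Index → ℂ) = fun j => ((Pi.single i (1 : ℤ) : K3Index → ℤ) j : ℂ) := by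
    intro i
    funext j
    by_cases hij : j = i
    · subst hij; simp
    · simp [hij]
  have hfixe : ∀ i : K3Index, g (Pi.single i 1) = Pi.single i 1 := by
    intro i
    obtain ⟨w, hw'⟩ := hgint (Pi.single i 1)
    -- the integral vector `g eᵢ - eᵢ`
    set q : K3Index → ℚ := fun j => ((w j - (Pi.single i (1 : ℤ) : K3Index → ℤ) j : ℤ) : ℚ) with hq
    have hqC : (fun j => (q j : ℂ)) = g (Pi.single i 1) - Pi.single i 1 := by
      rw [hcast i, hw']
      funext j
      simp [hq]
    -- orthogonal to `σ x`
    have hqorth : k3Form (fun j => (q j : ℂ)) (σ x) = 0 := by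
      have e1 : k3Form (g (Pi.single i 1)) (σ x) = k3Form (Pi.single i (1 : ℂ)) (σ x) := by
        conv_lhs => rw [← hfix]
        exact hg _ _
      rw [hqC, k3Form_sub_left, e1, sub_self]
    -- hence killed by `θ`, hence fixed by `π_U`
    have hθq : thetaC θ (fun j => (q j : ℂ)) = 0 := by
      rw [thetaC_ratCast, hgenσ q hqorth]
      funext j
      simp
    have hπq : πU[u₁, u₂] (fun j => (q j : ℂ)) = fun j => (q j : ℂ) := (thetaC_apply_eq_zero_iff hZ _).1 hθq
    -- but `π_U (g e - e) = 0`
    have hπq0 : πU[u₁, u₂] (fun j => (q j : ℂ)) = 0 := by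
      rw [hqC, map_sub, ← Module.End.mul_apply, piU_mul_g hZ, sub_self]
    rw [hπq0] at hπq
    rw [← sub_eq_zero, ← hqC, ← hπq]
  have hg1 : g = 1 := by
    refine (Pi.basisFun ℂ K3Index).ext fun i => ?_
    rw [Pi.basisFun_apply, Module.End.one_apply]
    exact hfixe i
  -- contradiction with `g y₀ = ζ₁₁ y₀`, `y₀ ≠ 0`, `ζ₁₁ ≠ 1`
  have hy0 : y₀ ≠ 0 := ne_zero_of_star_self_re_pos hy₀pos
  rw [hg1, Module.End.one_apply] at hgy₀
  have hζ : Complex.exp (2 * Real.pi * Complex.I / 11) = 1 := by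
    have h := congrArg (fun z => z - y₀) hgy₀
    simp only [sub_self] at h
    have h' : (Complex.exp (2 * Real.pi * Complex.I / 11) - 1) • y₀ = 0 := by
      rw [sub_smul, one_smul]; exact h.symm
    exact sub_eq_zero.1 ((smul_eq_zero.1 h').resolve_right hy0)
  have hprim : IsPrimitiveRoot (Complex.exp (2 * Real.pi * Complex.I / 11)) 11 := by
    have h := Complex.isPrimitiveRoot_exp 11 (by norm_num)
    exact_mod_cast h
  exact hprim.ne_one (by norm_num) hζ

/-! ### The quintic `P₁₁` and the sextic `Q₁₁` -/

/-- `X⁵ + X⁴ - 4X³ - 3X² + 3X + 1` (with `C`-coefficients) is the tree's `CyclicQuintic11.quinticPolyRat`.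
[folklore] -/
theorem quintic_eq_quinticPolyRat :
    (X ^ 5 + X ^ 4 - C (4 : ℚ) * X ^ 3 - C (3 : ℚ) * X ^ 2 + C (3 : ℚ) * X + 1 : ℚ[X]) =
      Literature.NumberTheory.NumberFields.CyclicQuintic11.quinticPolyRat := by
  rw [Literature.NumberTheory.NumberFields.CyclicQuintic11.quinticPolyRat_eq, map_ofNat C 4, map_ofNat C 3]

/-- A complex root of `P₁₁ = X⁵ + X⁴ - 4X³ - 3X² + 3X + 1` has minimal polynomial `P₁₁` (irreducible over
`ℚ`: tree theorem `CyclicQuintic11.quinticPolyRat_irreducible`), of degree `5`.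
[cite: Marcus2018, Ch. 2, Exercise 35] -/
theorem minpoly_natDegree_eq_five {e : ℂ} (he : e ^ 5 + e ^ 4 - 4 * e ^ 3 - 3 * e ^ 2 + 3 * e + 1 = 0) :
    (minpoly ℚ e).natDegree = 5 := by
  open Literature.NumberTheory.NumberFields.CyclicQuintic11 in
  have hmin : quinticPolyRat = minpoly ℚ e := by
    refine minpoly.eq_of_irreducible_of_monic quinticPolyRat_irreducible ?_ quinticPolyRat_monic
    rw [quinticPolyRat_eq]
    simp only [map_add, map_sub, map_mul, map_pow, aeval_X, map_one, map_ofNat]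
    exact he
  rw [← hmin, Literature.NumberTheory.NumberFields.CyclicQuintic11.quinticPolyRat_natDegree]

/-- `Q₁₁` is separable (`X - 2` and the irreducible quintic are coprime: `P₁₁(2) = 11 ≠ 0`). [folklore] -/
theorem sextic_separable : (Q₁₁).Separable := by
  open Literature.NumberTheory.NumberFields.CyclicQuintic11 in
  rw [quintic_eq_quinticPolyRat]
  refine Polynomial.separable_X_sub_C.mul quinticPolyRat_irreducible.separable ?_
  refine (Polynomial.irreducible_X_sub_C (2 : ℚ)).coprime_iff_not_dvd.2 fun h => ?_
  rw [Polynomial.dvd_iff_isRoot, Polynomial.IsRoot.def, quinticPolyRat_eq] at h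
  norm_num at h

/-- `Q₁₁(0) = -2 ≠ 0`. [folklore] -/
theorem sextic_eval_zero_ne : (Q₁₁).eval 0 ≠ 0 := by
  norm_num

/-! ### HC⁴(S ⊗ S) from the conjugacy alone -/

/-- **HC⁴(S ⊗ S) for every K3 surface of the ζ₁₁ real-multiplication type, from the conjugacy alone.** For
every datum `(g, u₁, u₂, y₀, θ)` of the named fact (an integral isometry `g` of `Λ` of order `11` with invariant
plane `ℤu₁ ⊕ ℤu₂ ≅ U`, a period point in its `ζ₁₁`-eigenspace, `θ_ℂ = (g + g¹⁰) - 2π_U`), EVERY projective K3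
surface `S`, marked by `(η, p, x)` and carrying an endomorphism `t` of `H²(S(ℂ); ℂ)` — rational, Hodge-type
preserving, killing `N¹H²`, with image cup-orthogonal to `N¹H²` — which is conjugate to `θ_ℂ` by a RATIONAL
ISOMETRY `σ` of `Λ_ℚ` (`σ(η(t c)) = θ_ℂ(σ(η c))`) satisfies `HodgeConjectureFor 4 (S ⊗ S)`. No Picard number, no
annihilating polynomial, no generation clause among the hypotheses: `Q₁₁ = (X - 2)P₁₁` annihilates `t` on `T(S)`
(`isAnnihilatedOnTranscendentalBy_sextic_of_zeta11Model`), the `(2,0)`-eigenvalue `ev` of `t` is a root of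
`Q₁₁` other than `2` (`eigenvalue_ne_two_of_zeta11Model`), so `minpoly_ℚ ev = P₁₁` has degree `5`;
`ρ(S) = 2` (`finrank_algebraicClasses_eq_two_of_zeta11Model`); by the one-cycle degree law
(`5jm + 2 ≠ 22` for `j ≥ 2`, `m ≥ 3`) either `t` generates `End_Hdg T(S)` — then
`hodgeConjectureFor_square_of_zeta11Type` (rational orbit density + Buskin transport + the ζ₁₁ open-family
fact) — or `S` has complex multiplication — then Buskin's CM corollary. These `S` are exactly the K3 surfaces
RM-isogenous to the members of the maximal van Geemen–Schütt ζ₁₁ family (cell (3,5)). CONDITIONAL on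
{`Buskin2019_hodgeIsometry_algebraic`, `VanGeemenSchuett2025_OguisoZhang2011_zeta11_cycleOnOpenPeriodSet`,
`Huybrechts_K3_marking_exists`, `Buskin2019_hodgeConjectureFor_square_of_CM`}; credits nothing; HC is NOT proved
here. [cite: GeemenSchutt2023, Thm. 1.1 (11), Prop. 4.6, §4.8, §5.8] [cite: OguisoZhang2011K3Order11, Thm. 1.5 (3)]
[cite: Vangeemen2008, Lemma 3.2] [cite: Zarhin1983HodgeGroupsK3, Thm. 1.5.1]
[cite: Buskin2019, Thm. 1.1 and Corollary] [cite: Huybrechts2016K3, Ch. 3 Cor. 3.6 and Thm. 3.7] -/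
theorem hodgeConjectureFor_square_of_zeta11Type_of_conj
    (hB : Buskin2019_hodgeIsometry_algebraic)
    (hV : VanGeemenSchuett2025_OguisoZhang2011_zeta11_cycleOnOpenPeriodSet)
    (hmark : Huybrechts_K3_marking_exists) (hCM : Buskin2019_hodgeConjectureFor_square_of_CM)
    (hZ : Zeta11Model[g, u₁, u₂, y₀, θ]) (hS : IsK3Surface S)
    (η : complexBetti S (2 * 1) ≃ₗ[ℂ] (K3Index → ℂ)) (p : complexBetti S (2 * 2)) (x : K3Index → ℂ)
    (hM : MarkedK3[S, η, p, x])
    (t : complexBetti S (2 * 1) →ₗ[ℂ] complexBetti S (2 * 1))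
    (ht_rat : ∀ y, IsRationalClass y → IsRationalClass (t y))
    (ht_typ : ∀ (i j : ℕ) (y : complexBetti S (2 * 1)),
      IsOfHodgeType 2 S (2 * 1) i j y → IsOfHodgeType 2 S (2 * 1) i j (t y))
    (ht_N : ∀ d ∈ algebraicClasses S 1, t d = 0)
    (ht_perp : ∀ (y : complexBetti S (2 * 1)), ∀ d ∈ algebraicClasses S 1,
      cupProduct (rfl : 2 * 1 + 2 * 1 = 2 * 2) (t y) d = 0)
    (σ : Module.End ℂ (K3Index → ℂ)) (hσ : ∀ a b, k3Form (σ a) (σ b) = k3Form a b)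
    (hσrat : ∀ v : K3Index → ℤ, ∃ w : K3Index → ℚ, σ (fun i => (v i : ℂ)) = fun i => (w i : ℂ))
    (hconj : ∀ c : complexBetti S (2 * 1), σ (η (t c)) = thetaC θ (σ (η c))) :
    HodgeConjectureFor 4 (S ⊗ S) := by
  classical
  have hHT : Huybrechts_K3_hodgeTypes_H2 := Huybrechts_K3_hodgeTypes_H2_holds
  have hP : IsAnnihilatedOnTranscendentalBy S t (Q₁₁) :=
    isAnnihilatedOnTranscendentalBy_sextic_of_zeta11Model hZ hS η p x hM t ht_typ σ hσ hσrat hconj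
  have hρ : Module.finrank ℂ ↥(algebraicClasses S 1) = 2 :=
    finrank_algebraicClasses_eq_two_of_zeta11Model hZ hS η p x hM t ht_typ ht_N σ hσ hσrat hconj
  obtain ⟨hp0, ⟨hpint, hpgen, hηint, hηcup, h20, hline⟩, hPer⟩ := hM
  have hM' : MarkedK3[S, η, p, x] := ⟨hp0, ⟨hpint, hpgen, hηint, hηcup, h20, hline⟩, hPer⟩
  have hx0 : η.symm x ≠ 0 := fun h0 =>
    ne_zero_of_star_self_re_pos hPer.2.1 (by simpa using congrArg η h0)
  obtain ⟨ev, hev⟩ := hline (t (η.symm x)) (ht_typ 2 0 _ h20)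
  have htransc : ∀ d ∈ algebraicClasses S 1,
      cupProduct (rfl : 2 * 1 + 2 * 1 = 2 * 2) (η.symm x) d = 0 := by
    intro d hd
    obtain ⟨-, -, h3⟩ := hHT S hS (η.symm x) h20 hx0
    have h11 : IsOfHodgeType 2 S (2 * 1) 1 1 d :=
      isOfHodgeType_of_mem_algebraicClasses_of_isSmoothProjective hS.isSmoothProjective 1 hd
    have hds := ((h3 d).1 h11).1
    rw [cupProduct_gradedComm_holds ℂ _ (rfl : 2 * 1 + 2 * 1 = 2 * 2) rfl]
    norm_num
    exact hds
  -- `ev` is a root of `Q₁₁`, not `2`, hence of the irreducible quintic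
  have hev2 : ev ≠ 2 := eigenvalue_ne_two_of_zeta11Model hZ hS η p x hM' t ht_N σ hσ hσrat hconj hev
  have hev5 : ev ^ 5 + ev ^ 4 - 4 * ev ^ 3 - 3 * ev ^ 2 + 3 * ev + 1 = 0 := by
    have h1 := hP (η.symm x) htransc
    rw [aeval_apply_of_eigen hev, smul_eq_zero] at h1
    have h2 := h1.resolve_right hx0
    rw [sextic_map_eq, Polynomial.eval_mul] at h2
    have h3 : Polynomial.eval ev (X - 2 : ℂ[X]) ≠ 0 := by
      rw [Polynomial.eval_sub, Polynomial.eval_X, Polynomial.eval_ofNat]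
      exact sub_ne_zero.2 hev2
    have h4 := (mul_eq_zero.1 h2).resolve_left h3
    simpa using h4
  have hdeg : (minpoly ℚ ev).natDegree = 5 := minpoly_natDegree_eq_five hev5
  have hk : ∀ j m : ℕ, 2 ≤ j → 3 ≤ m → 5 * j * m + Module.finrank ℂ ↥(algebraicClasses S 1) ≠ 22 := by
    intro j m hj hm
    rw [hρ]
    have : 30 ≤ 5 * j * m := by nlinarith
    omega
  rcases OneCycle.generatedBy_or_hasComplexMultiplication_of_eigenvalue_natDegree hmark hS hk t ht_rat ht_typ
      ⟨η.symm x, ev, h20, hx0, hev, hdeg⟩ with hgen | hCMS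
  · exact hodgeConjectureFor_square_of_zeta11Type hB hV hZ hS sextic_separable sextic_eval_zero_ne η p x hM' t
      ht_rat ht_typ ht_N ht_perp hP hgen σ hσ hσrat hconj
  · exact hCM S hS hCMS

/-! ### The NAMED explicit type `θ₁₁ = zeta11Theta` -/

/-- **Every K3 surface of the explicit ζ₁₁ rational RM type `θ₁₁ = zeta11Theta` has Picard number `2`**: for a
marked projective K3 surface `(S, η, p, x)` with an endomorphism `t` (type-preserving, killing `N¹(S)`) conjugate
by a rational isometry `σ` of `Λ_ℚ` to `(zeta11Theta)_ℂ`, `ρ(S) = 2` (`finrank_algebraicClasses_eq_two_of_zeta11Model`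
at gen 11's explicit datum `exists_zeta11Model_zeta11Theta`). Fact-free.
[cite: GeemenSchutt2023, Thm. 1.1 (11) and §5.8] [cite: OguisoZhang2011K3Order11, Thm. 1.5 (3)] -/
theorem finrank_algebraicClasses_eq_two_of_zeta11Theta (hS : IsK3Surface S)
    (η : complexBetti S (2 * 1) ≃ₗ[ℂ] (K3Index → ℂ)) (p : complexBetti S (2 * 2)) (x : K3Index → ℂ)
    (hM : MarkedK3[S, η, p, x])
    (t : complexBetti S (2 * 1) →ₗ[ℂ] complexBetti S (2 * 1))
    (ht_typ : ∀ (i j : ℕ) (y : complexBetti S (2 * 1)),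
      IsOfHodgeType 2 S (2 * 1) i j y → IsOfHodgeType 2 S (2 * 1) i j (t y))
    (ht_N : ∀ d ∈ algebraicClasses S 1, t d = 0)
    (σ : Module.End ℂ (K3Index → ℂ)) (hσ : ∀ a b, k3Form (σ a) (σ b) = k3Form a b)
    (hσrat : ∀ v : K3Index → ℤ, ∃ w : K3Index → ℚ, σ (fun i => (v i : ℂ)) = fun i => (w i : ℂ))
    (hconj : ∀ c : complexBetti S (2 * 1), σ (η (t c)) = thetaC zeta11Theta (σ (η c))) :
    Module.finrank ℂ ↥(algebraicClasses S 1) = 2 := by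
  obtain ⟨g, u₁, u₂, y₀, hZ⟩ := Zeta11ModelExists.exists_zeta11Model_zeta11Theta
  exact finrank_algebraicClasses_eq_two_of_zeta11Model hZ hS η p x hM t ht_typ ht_N σ hσ hσrat hconj

/-- **HC⁴(S ⊗ S) for every K3 surface of the NAMED explicit ζ₁₁ rational RM type `θ₁₁ = zeta11Theta`, from
the conjugacy alone**: every projective K3 surface `S` marked by `(η, p, x)` with an endomorphism `t` of
`H²(S(ℂ); ℂ)` (rational, type-preserving, killing `N¹H²`, image cup-orthogonal to `N¹H²`) conjugate by a
rational isometry `σ` of `Λ_ℚ` to `(zeta11Theta)_ℂ` satisfies `HodgeConjectureFor 4 (S ⊗ S)`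
(`hodgeConjectureFor_square_of_zeta11Type_of_conj` at `exists_zeta11Model_zeta11Theta`). These are the K3
surfaces RM-isogenous to the members `y² = x³ + bx + c₁p_{11,a}(t) + c₀` of the van Geemen–Schütt ζ₁₁ family
(cell (3,5): `E = ℚ(ζ₁₁ + ζ₁₁⁻¹)`, `ρ = 2` forced). CONDITIONAL on {`Buskin2019_hodgeIsometry_algebraic`,
`VanGeemenSchuett2025_OguisoZhang2011_zeta11_cycleOnOpenPeriodSet`, `Huybrechts_K3_marking_exists`,
`Buskin2019_hodgeConjectureFor_square_of_CM`}; credits nothing; HC is NOT proved here.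
[cite: GeemenSchutt2023, Thm. 1.1 (11), Prop. 4.6, §4.8, §5.8] [cite: OguisoZhang2011K3Order11, Thm. 1.5 (3)]
[cite: Buskin2019, Thm. 1.1 and Corollary] [cite: Huybrechts2016K3, Ch. 3 Cor. 3.6 and Thm. 3.7] -/
theorem hodgeConjectureFor_square_of_zeta11Theta_of_conj
    (hB : Buskin2019_hodgeIsometry_algebraic)
    (hV : VanGeemenSchuett2025_OguisoZhang2011_zeta11_cycleOnOpenPeriodSet)
    (hmark : Huybrechts_K3_marking_exists) (hCM : Buskin2019_hodgeConjectureFor_square_of_CM)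
    (hS : IsK3Surface S)
    (η : complexBetti S (2 * 1) ≃ₗ[ℂ] (K3Index → ℂ)) (p : complexBetti S (2 * 2)) (x : K3Index → ℂ)
    (hM : MarkedK3[S, η, p, x])
    (t : complexBetti S (2 * 1) →ₗ[ℂ] complexBetti S (2 * 1))
    (ht_rat : ∀ y, IsRationalClass y → IsRationalClass (t y))
    (ht_typ : ∀ (i j : ℕ) (y : complexBetti S (2 * 1)),
      IsOfHodgeType 2 S (2 * 1) i j y → IsOfHodgeType 2 S (2 * 1) i j (t y))
    (ht_N : ∀ d ∈ algebraicClasses S 1, t d = 0)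
    (ht_perp : ∀ (y : complexBetti S (2 * 1)), ∀ d ∈ algebraicClasses S 1,
      cupProduct (rfl : 2 * 1 + 2 * 1 = 2 * 2) (t y) d = 0)
    (σ : Module.End ℂ (K3Index → ℂ)) (hσ : ∀ a b, k3Form (σ a) (σ b) = k3Form a b)
    (hσrat : ∀ v : K3Index → ℤ, ∃ w : K3Index → ℚ, σ (fun i => (v i : ℂ)) = fun i => (w i : ℂ))
    (hconj : ∀ c : complexBetti S (2 * 1), σ (η (t c)) = thetaC zeta11Theta (σ (η c))) :
    HodgeConjectureFor 4 (S ⊗ S) := by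
  obtain ⟨g, u₁, u₂, y₀, hZ⟩ := Zeta11ModelExists.exists_zeta11Model_zeta11Theta
  exact hodgeConjectureFor_square_of_zeta11Type_of_conj hB hV hmark hCM hZ hS η p x hM t ht_rat ht_typ ht_N
    ht_perp σ hσ hσrat hconj

end Summit.HodgeConjecture.HodgeConjecture.Theorems.MarkmanPartnerTransport.RMTypeOrbit

end
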